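import Literature.NumberTheory.Sieve.SmoothEndgameArcs
import Literature.NumberTheory.Sieve.SmoothEndgameEuler
import Literature.NumberTheory.Sieve.SmoothEndgamePoints
import HarnessLib

/-!
# The endgame for smooth `a + b = c`: the arcs `a/q`, `2 ≤ q ≤ Λ/2`

Topic `Literature/NumberTheory/Sieve`; a PROVED file toward
`Literature.NumberTheory.DiophantineGeometry.XYZUpperHalf` ([Harper2016, Cor. 1], §5 with the
smooth weight `w(v) = v²(1−v)²`). On the arc `θ = a/q + λ/x` (`(a,q) = 1`, `2 ≤ q ≤ Λ/2`,
`|λ| ≤ Λ/2`) the arc estimate of `SmoothEndgameArcs` gives, with `b(q) = 2G_α(q) + ε'' H_α(q)`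
(`ε'' = ε + 2e^{−66}`; the non-principal characters being absorbed into `H_α(q) ≥ q^{−α}` by the
smallness hypothesis on `Λ⁴(1+Λ)𝓝`),
`‖S₃(θ)‖ ≤ 𝓜 b(q)/(1+|λ|)`, `‖S₁(θ)‖ ≤ 2𝓜₁ b(q)/(1+|λ|)` (`arc_pointwise`), hence summing over the
points of the arc (`∑ (1+|λ_r|)^{−2} ≤ 4`), over `a` (`φ(q)` classes) and over `q` with the Euler
product bounds of `SmoothEndgameEuler` (`1 − α ≤ 5·10⁻⁷`):

`∑_{2 ≤ q ≤ Λ/2} ∑_{(a,q)=1} ∑_{r ∈ arc(q,a)} ‖S₁(r/N₀)‖² ‖S₃(r/N₀)‖ ≤ 𝓜₁²𝓜/2^{32}` (`arcs_sum_le`).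

## References

* A. J. Harper, Compositio Math. 152 (2016), §5 [Harper2016].
-/

noncomputable section

open Finset Real Complex
open scoped FourierTransform

namespace Literature.NumberTheory.Sieve

namespace Endgame

open MontgomeryVaughan1975 TwistedWeight SmoothArcs Vinogradov

/-! ### Small lemmas -/

/-- `q^{−α} ≤ H_α(q)` (`q ≥ 1`). [folklore] -/
theorem rpow_neg_le_localH (α : ℝ) {q : ℕ} (hq : q ≠ 0) : (q : ℝ) ^ (-α) ≤ localH α q := by
  rw [localH_eq_prod α hq]
  have hq0 : (0 : ℝ) < q := by exact_mod_cast Nat.pos_of_ne_zero hq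
  have hqa : 0 < (q : ℝ) ^ (-α) := Real.rpow_pos_of_pos hq0 _
  have h1 : (1 : ℝ) ≤ ∏ p ∈ q.primeFactors, (((p : ℝ) + (p : ℝ) ^ α) / ((p : ℝ) - 1)) := by
    calc (1 : ℝ) = ∏ _p ∈ q.primeFactors, (1 : ℝ) := Finset.prod_const_one.symm
      _ ≤ _ := by
        refine Finset.prod_le_prod (fun _ _ => zero_le_one) fun p hp => ?_
        have hp2 : (2 : ℝ) ≤ p := by exact_mod_cast (Nat.prime_of_mem_primeFactors hp).two_le
        have hpa : 0 ≤ (p : ℝ) ^ α := Real.rpow_nonneg (by linarith) _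
        rw [le_div_iff₀ (by linarith)]; linarith
  nlinarith

/-- `(u + v)³ ≤ 4 (u³ + v³)` for `u, v ≥ 0` (cf. `Torus.add_pow_three_le`, in a file too heavy to
import here). [folklore] -/
private theorem add_pow_three_le {u v : ℝ} (hu : 0 ≤ u) (hv : 0 ≤ v) : (u + v) ^ 3 ≤ 4 * (u ^ 3 + v ^ 3) := by
  nlinarith [mul_nonneg (add_nonneg hu hv) (sq_nonneg (u - v)), mul_nonneg hu hv]

/-- `e^{−66} ≤ 2.718^{−66}` and `e^{130} ≤ 2.7183^{130}`. [folklore] -/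
theorem exp_neg_66_le_pow : Real.exp (-66) ≤ ((2718 / 1000 : ℝ) ^ 66)⁻¹ := by
  have hlo : (2718 / 1000 : ℝ) ≤ Real.exp 1 := by have := Real.exp_one_gt_d9; linarith
  have h66 : (2718 / 1000 : ℝ) ^ 66 ≤ Real.exp 66 := by
    calc (2718 / 1000 : ℝ) ^ 66 ≤ Real.exp 1 ^ 66 := pow_le_pow_left₀ (by norm_num) hlo 66
      _ = Real.exp 66 := by rw [← Real.exp_nat_mul]; norm_num
  rw [Real.exp_neg]
  exact inv_anti₀ (by positivity) h66

/-- `e^{130} ≤ 2.7183^{130}`. [folklore] -/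
theorem exp_130_le_pow : Real.exp 130 ≤ (27183 / 10000 : ℝ) ^ 130 := by
  have hhi : Real.exp 1 ≤ 27183 / 10000 := by have := Real.exp_one_lt_d9; linarith
  calc Real.exp 130 = Real.exp 1 ^ 130 := by rw [← Real.exp_nat_mul]; norm_num
    _ ≤ (27183 / 10000 : ℝ) ^ 130 := pow_le_pow_left₀ (Real.exp_pos 1).le hhi 130

/-- The numerical heart of the arcs `q ≥ 2`: for `1 − 5·10⁻⁷ ≤ α ≤ 1` and `ε ≤ e^{−66}`,
`32 (exp(2000(1−α)³/(3α−13/5)) − 1) + 4 (ε + 2e^{−66})³ exp(128/(3α−2)) ≤ 2^{−36}`. [cite: Harper2016, §5] -/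
theorem arcs_numeric {α ε : ℝ} (hα : 1 - 1 / 2000000 ≤ α) (hα1 : α ≤ 1) (hε : 0 < ε) (hε1 : ε ≤ Real.exp (-66)) :
    32 * (Real.exp (2000 * (1 - α) ^ 3 / (3 * α - 13 / 5)) - 1) +
      4 * (ε + 2 * Real.exp (-66)) ^ 3 * Real.exp (128 / (3 * α - 2)) ≤ (1 / 2 : ℝ) ^ 36 := by
  have h1α : 0 ≤ 1 - α := by linarith
  have h1α' : 1 - α ≤ 1 / 2000000 := by linarith
  -- the `G` part
  set t : ℝ := 2000 * (1 - α) ^ 3 / (3 * α - 13 / 5) with ht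
  have hden : 39 / 100 ≤ 3 * α - 13 / 5 := by linarith
  have ht0 : 0 ≤ t := by rw [ht]; positivity
  have hcube : (1 - α) ^ 3 ≤ (1 / 2000000) ^ 3 := pow_le_pow_left₀ h1α h1α' 3
  have htle : t ≤ 1 / 10 ^ 14 := by
    rw [ht, div_le_iff₀ (by linarith)]
    nlinarith
  have hexp : Real.exp t - 1 ≤ 2 * t := by
    have h := Real.abs_exp_sub_one_le (x := t) (by rw [abs_of_nonneg ht0]; linarith)
    rw [abs_of_nonneg ht0] at h
    exact le_trans (le_abs_self _) h
  -- the `H` part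
  set e66 : ℝ := ((2718 / 1000 : ℝ) ^ 66)⁻¹ with he66
  have h66 : Real.exp (-66) ≤ e66 := by rw [he66]; exact exp_neg_66_le_pow
  have hε3 : (ε + 2 * Real.exp (-66)) ^ 3 ≤ (3 * e66) ^ 3 := by
    apply pow_le_pow_left₀ (by positivity)
    linarith
  have hexpH : Real.exp (128 / (3 * α - 2)) ≤ Real.exp 130 := by
    apply Real.exp_le_exp.mpr
    rw [div_le_iff₀ (by linarith)]; nlinarith
  have hH : 4 * (ε + 2 * Real.exp (-66)) ^ 3 * Real.exp (128 / (3 * α - 2)) ≤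
      4 * (3 * e66) ^ 3 * (27183 / 10000 : ℝ) ^ 130 := by
    apply mul_le_mul (mul_le_mul_of_nonneg_left hε3 (by norm_num)) (hexpH.trans exp_130_le_pow) (Real.exp_pos _).le
      (by positivity)
  have hG : 32 * (Real.exp t - 1) ≤ 64 * (1 / 10 ^ 14) := by linarith
  calc 32 * (Real.exp t - 1) + 4 * (ε + 2 * Real.exp (-66)) ^ 3 * Real.exp (128 / (3 * α - 2))
      ≤ 64 * (1 / 10 ^ 14) + 4 * (3 * e66) ^ 3 * (27183 / 10000 : ℝ) ^ 130 := add_le_add hG hH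
    _ ≤ (1 / 2 : ℝ) ^ 36 := by rw [he66]; norm_num

/-! ### Pointwise on an arc -/

set_option maxHeartbeats 1600000 in
/-- **Pointwise on the arc `a/q + λ/x`**, `2 ≤ q ≤ Λ/2`, `(a,q) = 1`, `|λ| ≤ Λ/2`: in the regime of
`arc_estimate`, if `Λ⁴ (1+Λ) (x^αζ(α,y)/2π) ν(Λ) ≤ e^{−66} 𝓜₁`, then with
`b = 2G_α(q) + (ε + 2e^{−66}) H_α(q)`:
`‖S₁(a/q+λ/x)‖² ‖S₃(a/q+λ/x)‖ ≤ 4 𝓜₁²𝓜 b³ (1+|λ|)^{−2}`. [cite: Harper2016, §5] -/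
theorem arc_pointwise {ε : ℝ} (hε : 0 < ε) {δ₀ θ : ℝ} (hδ₀ : 0 ≤ δ₀) (hδ₀' : δ₀ ≤ 1 / 20)
    (hθ0 : 0 < θ) (hθ : θ ≤ 1 / 5) :
    ∃ x₀ : ℝ, ∀ (x : ℝ) (y : ℕ), x₀ ≤ x → Real.log x ^ 4 ≤ y → (y : ℝ) ≤ x →
      Real.log y ≤ Real.log x ^ (1 / 6 : ℝ) → GoodLevel δ₀ θ y → 25 ≤ Real.log y →
      40 * ((y : ℝ) ^ (1 - θ) + 1) ≤ (y : ℝ) ^ (1 - θ / 2) → (y : ℝ) ^ θ + 1 ≤ (y : ℝ) ^ (1 - θ / 2) →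
      3 * (y : ℝ) ^ (1 - θ / 2) ≤ y →
      ∀ Λ : ℝ, 2 ≤ Λ → Λ ^ 8 ≤ (y : ℝ) → Λ ≤ (y : ℝ) ^ θ → Λ ≤ Real.log x ^ 100 →
      Λ ^ 4 * (1 + Λ) * ((x ^ saddlePoint x y * smoothZeta (saddlePoint x y) y / (2 * π)) *
          decayNu y θ (saddlePoint x y) Λ) ≤
        Real.exp (-66) * ((2 : ℝ) ^ (-saddlePoint x y) * (x ^ saddlePoint x y * smoothZeta (saddlePoint x y) y /
          Real.sqrt (2 * Real.pi * saddlePhi₂ (saddlePoint x y) y))) →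
      ∀ q : ℕ, 2 ≤ q → (q : ℝ) ≤ Λ / 2 → ∀ a : ℕ, a.Coprime q → ∀ lam : ℝ, |lam| ≤ Λ / 2 →
      ‖smoothWeightSum (x / 2) y ((a : ℝ) / q + lam / x)‖ ^ 2 * ‖smoothWeightSum x y ((a : ℝ) / q + lam / x)‖ ≤
        4 * (((2 : ℝ) ^ (-saddlePoint x y) * (x ^ saddlePoint x y * smoothZeta (saddlePoint x y) y /
              Real.sqrt (2 * Real.pi * saddlePhi₂ (saddlePoint x y) y))) ^ 2 *
            (x ^ saddlePoint x y * smoothZeta (saddlePoint x y) y /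
              Real.sqrt (2 * Real.pi * saddlePhi₂ (saddlePoint x y) y))) *
          (2 * localG (saddlePoint x y) q + (ε + 2 * Real.exp (-66)) * localH (saddlePoint x y) q) ^ 3 *
          (1 / (1 + |lam|) ^ 2) := by
  obtain ⟨x₀A, hA⟩ := arc_estimate hε hδ₀ hδ₀' hθ0 hθ
  obtain ⟨x₃₅, h35⟩ := three_fifths_le_saddlePoint
  obtain ⟨x₁, hlt1⟩ := saddlePoint_lt_one
  refine ⟨max (max x₀A x₃₅) (max x₁ (Real.exp 1)), fun x y hx hy4 hyx hylog hgood hy25 hy40 hyq hy3 Λ hΛ2 hΛ8 hΛθ hΛL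
    hsmall q hq2 hqΛ a ha lam hlam => ?_⟩
  have hx₀A : x₀A ≤ x := le_trans ((le_max_left _ _).trans (le_max_left _ _)) hx
  have hx₃₅ : x₃₅ ≤ x := le_trans ((le_max_right _ _).trans (le_max_left _ _)) hx
  have hx₁ : x₁ ≤ x := le_trans ((le_max_left _ _).trans (le_max_right _ _)) hx
  have hxe : Real.exp 1 ≤ x := le_trans ((le_max_right _ _).trans (le_max_right _ _)) hx
  have hx0 : 0 < x := lt_of_lt_of_le (Real.exp_pos 1) hxe
  have hlogx1 : 1 ≤ Real.log x := by
    have := Real.log_le_log (Real.exp_pos 1) hxe; rwa [Real.log_exp] at this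
  have hy3' : Real.log x ^ 3 ≤ y := le_trans (pow_le_pow_right₀ hlogx1 (by norm_num)) hy4
  set α : ℝ := saddlePoint x y with hα
  have hα35 : 3 / 5 ≤ α := h35 x y hx₃₅ hy3' hyx
  have hα1 : α ≤ 1 := (hlt1 x y hx₁ hy3' hyx hylog).le
  have hα0 : 0 < α := by linarith
  set Mx : ℝ := x ^ α * smoothZeta α y / Real.sqrt (2 * Real.pi * saddlePhi₂ α y) with hMx
  set M₁ : ℝ := (2 : ℝ) ^ (-α) * Mx with hM₁
  have hζ : 0 < smoothZeta α y := smoothZeta_pos hα0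
  have hMx0 : 0 ≤ Mx := by rw [hMx]; positivity
  have h2α : (2 : ℝ) ^ (-α) ≤ 1 := Real.rpow_le_one_of_one_le_of_nonpos (by norm_num) (by linarith)
  have h2α0 : 0 < (2 : ℝ) ^ (-α) := Real.rpow_pos_of_pos (by norm_num) _
  have hM₁0 : 0 ≤ M₁ := by positivity
  have hM₁le : M₁ ≤ Mx := by rw [hM₁]; nlinarith
  have hΛ1 : 1 ≤ Λ := by linarith
  have hq0 : q ≠ 0 := by omega
  haveI : NeZero q := ⟨hq0⟩
  have hqΛ' : (q : ℝ) ≤ Λ := by linarith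
  have hq1L : ((1 * q : ℕ) : ℝ) ≤ Real.log x ^ 100 := by push_cast; linarith
  have hq2L : ((2 * q : ℕ) : ℝ) ≤ Real.log x ^ 100 := by push_cast; linarith
  have hlamΛ : |lam| ≤ Λ := by linarith
  have hlamΛ2 : |lam / 2| ≤ Λ := by rw [abs_div, abs_two]; linarith [abs_nonneg lam]
  -- ### the arc estimates at `e₀ = 1, 2`
  have hA₃ := hA x y hx₀A hy4 hyx hylog hgood hy25 hy40 hyq hy3 Λ hΛ1 hΛ8 hΛθ 1 le_rfl q hqΛ' hq1L a ha lam hlamΛ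
  have hA₁ := hA x y hx₀A hy4 hyx hylog hgood hy25 hy40 hyq hy3 Λ hΛ1 hΛ8 hΛθ 2 (by norm_num) q hqΛ' hq2L a ha (lam / 2) hlamΛ2
  rw [← hα] at hA₃ hA₁
  simp only [Nat.cast_one, div_one, Real.one_rpow, one_mul, Nat.cast_ofNat] at hA₃ hA₁
  rw [← hMx] at hA₃ hA₁
  rw [← hM₁] at hA₁
  -- the angles
  have hθ₃ : smoothWeightSum x y ((a : ℝ) / q + lam / x) = arcSum x y q a lam := smoothWeightSum_eq_arcSum hx0 y q a lam
  have hθ₁ : smoothWeightSum (x / 2) y ((a : ℝ) / q + lam / x) = arcSum (x / 2) y q a (lam / 2) := by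
    have := smoothWeightSum_eq_arcSum (half_pos hx0) y q a (lam / 2)
    have e : lam / 2 / (x / 2) = lam / x := by field_simp
    rwa [e] at this
  rw [hθ₃, hθ₁]
  -- ### names
  set G : ℝ := localG α q with hG
  set H : ℝ := localH α q with hH
  set 𝓝 : ℝ := (x ^ α * smoothZeta α y / (2 * π)) * decayNu y θ α Λ with h𝓝
  have hG0 : 0 ≤ G := (localG_bounds hα1 hq0).1
  have hH0 : 0 ≤ H := (localH_bounds hα1 hq0).1
  have hπ := Real.pi_pos
  have h𝓝0 : 0 ≤ 𝓝 := by have := decayNu_nonneg y θ α Λ; positivity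
  have hl0 : 0 ≤ |lam| := abs_nonneg lam
  have hden : 0 < 1 + |lam| := by linarith
  -- the non-principal part is `≤ e^{-66} M₁ H/(1+|λ|)`
  have hHlow : 1 / Λ ≤ H := by
    have h1 : (q : ℝ) ^ (-α) ≤ H := rpow_neg_le_localH α hq0
    have hq0' : (0 : ℝ) < q := by exact_mod_cast Nat.pos_of_ne_zero hq0
    have h2 : (q : ℝ)⁻¹ ≤ (q : ℝ) ^ (-α) := by
      rw [← Real.rpow_neg_one]
      exact Real.rpow_le_rpow_of_exponent_le (by exact_mod_cast Nat.one_le_iff_ne_zero.mpr hq0) (by linarith)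
    have h3 : 1 / Λ ≤ (q : ℝ)⁻¹ := by rw [one_div]; exact inv_anti₀ hq0' hqΛ'
    linarith
  have hNP : (q : ℝ) ^ 2 * Real.sqrt q * 𝓝 ≤ Real.exp (-66) * M₁ * H / (1 + |lam|) := by
    have hq0' : (0 : ℝ) ≤ q := Nat.cast_nonneg q
    have hsq : Real.sqrt q ≤ Λ := by
      calc Real.sqrt q ≤ Real.sqrt (Λ ^ 2) := Real.sqrt_le_sqrt (by nlinarith)
        _ = Λ := Real.sqrt_sq (by linarith)
    have h1 : (q : ℝ) ^ 2 * Real.sqrt q * 𝓝 ≤ Λ ^ 3 * 𝓝 := by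
      apply mul_le_mul_of_nonneg_right _ h𝓝0
      calc (q : ℝ) ^ 2 * Real.sqrt q ≤ Λ ^ 2 * Λ :=
            mul_le_mul (pow_le_pow_left₀ hq0' hqΛ' 2) hsq (Real.sqrt_nonneg _) (by positivity)
        _ = Λ ^ 3 := by ring
    -- `Λ³ 𝓝 ≤ Λ³ 𝓝 (Λ H) = Λ⁴ 𝓝 H ≤ e^{-66} M₁ H/(1+Λ)`
    have h2 : Λ ^ 3 * 𝓝 ≤ Λ ^ 4 * 𝓝 * H := by
      have : 1 ≤ Λ * H := by
        have := mul_le_mul_of_nonneg_left hHlow (by linarith : (0 : ℝ) ≤ Λ)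
        rwa [mul_one_div_cancel (by linarith : Λ ≠ 0)] at this
      have h0 : 0 ≤ Λ ^ 3 * 𝓝 := by positivity
      nlinarith
    have h3 : Λ ^ 4 * 𝓝 * H ≤ Real.exp (-66) * M₁ / (1 + Λ) * H := by
      apply mul_le_mul_of_nonneg_right _ hH0
      rw [le_div_iff₀ (by linarith)]
      calc Λ ^ 4 * 𝓝 * (1 + Λ) = Λ ^ 4 * (1 + Λ) * 𝓝 := by ring
        _ ≤ Real.exp (-66) * M₁ := by rw [h𝓝]; exact hsmall
    have h4 : Real.exp (-66) * M₁ / (1 + Λ) * H ≤ Real.exp (-66) * M₁ * H / (1 + |lam|) := by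
      rw [div_mul_eq_mul_div]
      exact div_le_div_of_nonneg_left (by positivity) hden (by linarith)
    linarith
  -- ### `‖S₃‖ ≤ Mx b/(1+|λ|)` and `‖S₁‖ ≤ 2 M₁ b/(1+|λ|)`
  set b : ℝ := 2 * G + (ε + 2 * Real.exp (-66)) * H with hb
  have hb0 : 0 ≤ b := by positivity
  have hW := norm_twistMellin_le_two_div hα0 hα1 (show |(0 : ℝ)| ≤ 3 by norm_num) lam
  have hW' := norm_twistMellin_le_two_div hα0 hα1 (show |(0 : ℝ)| ≤ 3 by norm_num) (lam / 2)
  simp only [Complex.ofReal_zero, zero_mul, add_zero] at hW hW'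
  have hmain₃ : ‖(Mx : ℂ) * twistMellin lam α * (G : ℂ)‖ ≤ Mx * (2 / (1 + |lam|)) * G := by
    rw [norm_mul, norm_mul, Complex.norm_real, Complex.norm_real, Real.norm_eq_abs, Real.norm_eq_abs,
      abs_of_nonneg hMx0, abs_of_nonneg hG0]
    exact mul_le_mul_of_nonneg_right (mul_le_mul_of_nonneg_left hW hMx0) hG0
  have hmain₁ : ‖(M₁ : ℂ) * twistMellin (lam / 2) α * (G : ℂ)‖ ≤ M₁ * (2 / (1 + |lam / 2|)) * G := by
    rw [norm_mul, norm_mul, Complex.norm_real, Complex.norm_real, Real.norm_eq_abs, Real.norm_eq_abs,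
      abs_of_nonneg hM₁0, abs_of_nonneg hG0]
    exact mul_le_mul_of_nonneg_right (mul_le_mul_of_nonneg_left hW' hM₁0) hG0
  have hhalf : 1 / (1 + |lam / 2|) ≤ 2 / (1 + |lam|) := by
    rw [abs_div, abs_two, div_le_div_iff₀ (by positivity) hden]; linarith
  have hS₃ : ‖arcSum x y q a lam‖ ≤ Mx * b / (1 + |lam|) := by
    have h : ‖arcSum x y q a lam‖ ≤ Mx * (2 / (1 + |lam|)) * G +
        ((ε + Real.exp (-66)) * H * Mx / (1 + |lam|) + (q : ℝ) ^ 2 * Real.sqrt q * 𝓝) := by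
      have := norm_le_norm_add_norm_sub' (arcSum x y q a lam) ((Mx : ℂ) * twistMellin lam α * (G : ℂ))
      linarith
    -- `h : ‖S₃‖ ≤ Mx (2/(1+|λ|)) G + (ε' H Mx/(1+|λ|) + q²√q 𝓝)`
    calc ‖arcSum x y q a lam‖ ≤ Mx * (2 / (1 + |lam|)) * G +
          ((ε + Real.exp (-66)) * H * Mx / (1 + |lam|) + (q : ℝ) ^ 2 * Real.sqrt q * 𝓝) := h
      _ ≤ Mx * (2 / (1 + |lam|)) * G + ((ε + Real.exp (-66)) * H * Mx / (1 + |lam|) +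
            Real.exp (-66) * Mx * H / (1 + |lam|)) := by
          have : Real.exp (-66) * M₁ * H / (1 + |lam|) ≤ Real.exp (-66) * Mx * H / (1 + |lam|) := by
            apply div_le_div_of_nonneg_right _ hden.le
            exact mul_le_mul_of_nonneg_right (mul_le_mul_of_nonneg_left hM₁le (Real.exp_pos _).le) hH0
          linarith
      _ = Mx * b / (1 + |lam|) := by rw [hb]; field_simp; ring
  have hS₁ : ‖arcSum (x / 2) y q a (lam / 2)‖ ≤ 2 * M₁ * b / (1 + |lam|) := by
    have h : ‖arcSum (x / 2) y q a (lam / 2)‖ ≤ M₁ * (2 / (1 + |lam / 2|)) * G +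
        ((ε + Real.exp (-66)) * H * M₁ / (1 + |lam / 2|) + (q : ℝ) ^ 2 * Real.sqrt q * 𝓝) := by
      have := norm_le_norm_add_norm_sub' (arcSum (x / 2) y q a (lam / 2)) ((M₁ : ℂ) * twistMellin (lam / 2) α * (G : ℂ))
      linarith
    have hd2 : 0 < 1 + |lam / 2| := by positivity
    calc ‖arcSum (x / 2) y q a (lam / 2)‖ ≤ M₁ * (2 / (1 + |lam / 2|)) * G +
          ((ε + Real.exp (-66)) * H * M₁ / (1 + |lam / 2|) + (q : ℝ) ^ 2 * Real.sqrt q * 𝓝) := h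
      _ ≤ M₁ * (2 * (2 / (1 + |lam|))) * G +
          ((ε + Real.exp (-66)) * H * M₁ * (2 / (1 + |lam|)) + Real.exp (-66) * M₁ * H / (1 + |lam|)) := by
          have e1 : M₁ * (2 / (1 + |lam / 2|)) * G = (2 * M₁ * G) * (1 / (1 + |lam / 2|)) := by ring
          have e2 : (ε + Real.exp (-66)) * H * M₁ / (1 + |lam / 2|) =
              ((ε + Real.exp (-66)) * H * M₁) * (1 / (1 + |lam / 2|)) := by ring
          have i1 : (2 * M₁ * G) * (1 / (1 + |lam / 2|)) ≤ (2 * M₁ * G) * (2 / (1 + |lam|)) :=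
            mul_le_mul_of_nonneg_left hhalf (by positivity)
          have i2 : ((ε + Real.exp (-66)) * H * M₁) * (1 / (1 + |lam / 2|)) ≤
              ((ε + Real.exp (-66)) * H * M₁) * (2 / (1 + |lam|)) :=
            mul_le_mul_of_nonneg_left hhalf (by positivity)
          rw [e1, e2]
          nlinarith
      _ ≤ 2 * M₁ * b / (1 + |lam|) := by
          have hpos : 0 ≤ Real.exp (-66) * M₁ * H / (1 + |lam|) := by positivity
          have key : 2 * M₁ * b / (1 + |lam|) = M₁ * (2 * (2 / (1 + |lam|))) * G +
              ((ε + Real.exp (-66)) * H * M₁ * (2 / (1 + |lam|)) + Real.exp (-66) * M₁ * H / (1 + |lam|)) +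
              Real.exp (-66) * M₁ * H / (1 + |lam|) := by
            rw [hb]; field_simp; ring
          linarith
  -- ### the product
  have hS₃' : ‖arcSum x y q a lam‖ ≤ Mx * b * (1 / (1 + |lam|)) := by rw [← div_eq_mul_one_div]; exact hS₃
  have hS₁' : ‖arcSum (x / 2) y q a (lam / 2)‖ ≤ 2 * M₁ * b * (1 / (1 + |lam|)) := by
    rw [← div_eq_mul_one_div]; exact hS₁
  have hu : 1 / (1 + |lam|) ≤ 1 := by rw [div_le_one hden]; linarith
  have hu0 : 0 ≤ 1 / (1 + |lam|) := by positivity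
  calc ‖arcSum (x / 2) y q a (lam / 2)‖ ^ 2 * ‖arcSum x y q a lam‖
      ≤ (2 * M₁ * b * (1 / (1 + |lam|))) ^ 2 * (Mx * b * (1 / (1 + |lam|))) :=
        mul_le_mul (pow_le_pow_left₀ (norm_nonneg _) hS₁' 2) hS₃' (norm_nonneg _) (by positivity)
    _ = 4 * (M₁ ^ 2 * Mx) * b ^ 3 * (1 / (1 + |lam|)) ^ 2 * (1 / (1 + |lam|)) := by ring
    _ ≤ 4 * (M₁ ^ 2 * Mx) * b ^ 3 * (1 / (1 + |lam|)) ^ 2 * 1 := by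
        apply mul_le_mul_of_nonneg_left hu (by positivity)
    _ = 4 * (M₁ ^ 2 * Mx) * b ^ 3 * (1 / (1 + |lam|) ^ 2) := by rw [one_div_pow]; ring


/-! ### Summing over the arcs -/

set_option maxHeartbeats 1600000 in
/-- **The arcs `2 ≤ q ≤ Λ/2`.** In the regime of `arc_pointwise`, with `ε ≤ e^{−66}` and
`1 − 5·10⁻⁷ ≤ α(x,y)`:
`∑_{2 ≤ q ≤ Λ/2} ∑_{(a,q)=1} ∑_{r : |r/N₀ − a/q| ≤ Λ/(2x)} ‖S₁(r/N₀)‖² ‖S₃(r/N₀)‖ ≤ 2^{−32} 𝓜₁² 𝓜`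
(`N₀ = ⌊x⌋`). [cite: Harper2016, §5] -/
theorem arcs_sum_le {ε : ℝ} (hε : 0 < ε) (hε1 : ε ≤ Real.exp (-66)) {δ₀ θ : ℝ} (hδ₀ : 0 ≤ δ₀) (hδ₀' : δ₀ ≤ 1 / 20)
    (hθ0 : 0 < θ) (hθ : θ ≤ 1 / 5) :
    ∃ x₀ : ℝ, ∀ (x : ℝ) (y : ℕ), x₀ ≤ x → Real.log x ^ 4 ≤ y → (y : ℝ) ≤ x →
      Real.log y ≤ Real.log x ^ (1 / 6 : ℝ) → GoodLevel δ₀ θ y → 25 ≤ Real.log y →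
      40 * ((y : ℝ) ^ (1 - θ) + 1) ≤ (y : ℝ) ^ (1 - θ / 2) → (y : ℝ) ^ θ + 1 ≤ (y : ℝ) ^ (1 - θ / 2) →
      3 * (y : ℝ) ^ (1 - θ / 2) ≤ y →
      ∀ Λ : ℝ, 2 ≤ Λ → Λ ^ 8 ≤ (y : ℝ) → Λ ≤ (y : ℝ) ^ θ → Λ ≤ Real.log x ^ 100 →
      Λ ^ 4 * (1 + Λ) * ((x ^ saddlePoint x y * smoothZeta (saddlePoint x y) y / (2 * π)) *
          decayNu y θ (saddlePoint x y) Λ) ≤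
        Real.exp (-66) * ((2 : ℝ) ^ (-saddlePoint x y) * (x ^ saddlePoint x y * smoothZeta (saddlePoint x y) y /
          Real.sqrt (2 * Real.pi * saddlePhi₂ (saddlePoint x y) y))) →
      1 - 1 / 2000000 ≤ saddlePoint x y →
      (∑ q ∈ Finset.Icc 2 ⌊Λ / 2⌋₊, ∑ a ∈ (Finset.range q).filter (fun a : ℕ => q.Coprime a),
        ∑ r ∈ (Finset.range ⌊x⌋₊).filter (fun r : ℕ => |(r : ℝ) / ⌊x⌋₊ - (a : ℝ) / q| ≤ Λ / 2 / x),
          ‖smoothWeightSum (x / 2) y ((r : ℝ) / ⌊x⌋₊)‖ ^ 2 * ‖smoothWeightSum x y ((r : ℝ) / ⌊x⌋₊)‖) ≤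
        (((2 : ℝ) ^ (-saddlePoint x y) * (x ^ saddlePoint x y * smoothZeta (saddlePoint x y) y /
              Real.sqrt (2 * Real.pi * saddlePhi₂ (saddlePoint x y) y))) ^ 2 *
            (x ^ saddlePoint x y * smoothZeta (saddlePoint x y) y /
              Real.sqrt (2 * Real.pi * saddlePhi₂ (saddlePoint x y) y))) * (1 / 2 : ℝ) ^ 32 := by
  classical
  obtain ⟨x₀, hP⟩ := arc_pointwise hε hδ₀ hδ₀' hθ0 hθ
  obtain ⟨x₁, hlt1⟩ := saddlePoint_lt_one
  refine ⟨max (max x₀ x₁) (Real.exp 1), fun x y hx hy4 hyx hylog hgood hy25 hy40 hyq hy3 Λ hΛ2 hΛ8 hΛθ hΛL hsmall hαlo => ?_⟩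
  have hx₀ : x₀ ≤ x := le_trans ((le_max_left _ _).trans (le_max_left _ _)) hx
  have hx₁ : x₁ ≤ x := le_trans ((le_max_right _ _).trans (le_max_left _ _)) hx
  have hxe : Real.exp 1 ≤ x := le_trans (le_max_right _ _) hx
  have hx0 : 0 < x := lt_of_lt_of_le (Real.exp_pos 1) hxe
  have hlogx1 : 1 ≤ Real.log x := by
    have := Real.log_le_log (Real.exp_pos 1) hxe; rwa [Real.log_exp] at this
  have hx1 : 1 ≤ x := le_trans (by have := Real.add_one_le_exp (1 : ℝ); linarith) hxe
  have hy3' : Real.log x ^ 3 ≤ y := le_trans (pow_le_pow_right₀ hlogx1 (by norm_num)) hy4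
  set N₀ : ℕ := ⌊x⌋₊ with hN₀
  have hN₀pos : 0 < N₀ := Nat.le_floor (by simpa using hx1)
  have hN₀x : (N₀ : ℝ) ≤ x := Nat.floor_le hx0.le
  have hN₀0 : (0 : ℝ) < N₀ := by exact_mod_cast hN₀pos
  set α : ℝ := saddlePoint x y with hα
  have hα1 : α ≤ 1 := (hlt1 x y hx₁ hy3' hyx hylog).le
  set Mx : ℝ := x ^ α * smoothZeta α y / Real.sqrt (2 * Real.pi * saddlePhi₂ α y) with hMx
  set M₁ : ℝ := (2 : ℝ) ^ (-α) * Mx with hM₁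
  set T : ℝ := M₁ ^ 2 * Mx with hT
  have hy2 : 2 ≤ y := by
    have hy1 : (1 : ℝ) < y := by
      by_contra h0; push Not at h0
      have := Real.log_nonpos (Nat.cast_nonneg y) h0; linarith
    have : 1 < y := by exact_mod_cast hy1
    omega
  have hα0 : 0 < α := saddlePoint_pos (by linarith) hy2
  have hζ : 0 < smoothZeta α y := smoothZeta_pos hα0
  have hMx0 : 0 ≤ Mx := by rw [hMx]; positivity
  have hT0 : 0 ≤ T := by rw [hT, hM₁]; positivity
  set b : ℕ → ℝ := fun q => 2 * localG α q + (ε + 2 * Real.exp (-66)) * localH α q with hb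
  -- ### the innermost sum: one arc
  have harc : ∀ q ∈ Finset.Icc 2 ⌊Λ / 2⌋₊, ∀ a ∈ (Finset.range q).filter (fun a : ℕ => q.Coprime a),
      ∑ r ∈ (Finset.range N₀).filter (fun r : ℕ => |(r : ℝ) / N₀ - (a : ℝ) / q| ≤ Λ / 2 / x),
        ‖smoothWeightSum (x / 2) y ((r : ℝ) / N₀)‖ ^ 2 * ‖smoothWeightSum x y ((r : ℝ) / N₀)‖ ≤ 16 * T * b q ^ 3 := by
    intro q hq a ha
    obtain ⟨hq2, hqQ⟩ := Finset.mem_Icc.mp hq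
    have hqΛ : (q : ℝ) ≤ Λ / 2 := le_trans (by exact_mod_cast hqQ) (Nat.floor_le (by linarith))
    have hcop : a.Coprime q := (Nat.coprime_comm.mp (Finset.mem_filter.mp ha).2)
    have hq0 : (0 : ℝ) < q := by exact_mod_cast (show 0 < q by omega)
    have hcq : 0 ≤ (a : ℝ) / q := by positivity
    have hb0 : 0 ≤ b q := by
      have := (localG_bounds hα1 (show q ≠ 0 by omega)).1
      have := (localH_bounds hα1 (show q ≠ 0 by omega)).1
      simp only [hb]; positivity
    have hpt : ∀ r ∈ (Finset.range N₀).filter (fun r : ℕ => |(r : ℝ) / N₀ - (a : ℝ) / q| ≤ Λ / 2 / x),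
        ‖smoothWeightSum (x / 2) y ((r : ℝ) / N₀)‖ ^ 2 * ‖smoothWeightSum x y ((r : ℝ) / N₀)‖ ≤
          4 * T * b q ^ 3 * (1 / (1 + |((r : ℝ) / N₀ - (a : ℝ) / q) * x|) ^ 2) := by
      intro r hr
      obtain ⟨-, hrarc⟩ := Finset.mem_filter.mp hr
      set lam : ℝ := ((r : ℝ) / N₀ - (a : ℝ) / q) * x with hlam
      have hlamΛ : |lam| ≤ Λ / 2 := by
        rw [hlam, abs_mul, abs_of_pos hx0]
        have := mul_le_mul_of_nonneg_right hrarc hx0.le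
        rwa [div_mul_cancel₀ _ hx0.ne'] at this
      have hθr : (r : ℝ) / N₀ = (a : ℝ) / q + lam / x := by rw [hlam]; field_simp; ring
      have h := hP x y hx₀ hy4 hyx hylog hgood hy25 hy40 hyq hy3 Λ hΛ2 hΛ8 hΛθ hΛL hsmall q hq2 hqΛ a hcop lam hlamΛ
      rw [← hθr] at h
      exact h
    calc _ ≤ ∑ r ∈ (Finset.range N₀).filter (fun r : ℕ => |(r : ℝ) / N₀ - (a : ℝ) / q| ≤ Λ / 2 / x),
          4 * T * b q ^ 3 * (1 / (1 + |((r : ℝ) / N₀ - (a : ℝ) / q) * x|) ^ 2) := Finset.sum_le_sum hpt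
      _ ≤ ∑ r ∈ Finset.range N₀, 4 * T * b q ^ 3 * (1 / (1 + |((r : ℝ) / N₀ - (a : ℝ) / q) * x|) ^ 2) :=
          Finset.sum_le_sum_of_subset_of_nonneg (Finset.filter_subset _ _) fun r _ _ => by positivity
      _ = 4 * T * b q ^ 3 * ∑ r ∈ Finset.range N₀, 1 / (1 + |((r : ℝ) / N₀ - (a : ℝ) / q) * x|) ^ 2 := by
          rw [Finset.mul_sum]
      _ ≤ 4 * T * b q ^ 3 * 4 :=
          mul_le_mul_of_nonneg_left (sum_range_inv_one_add_abs_arc_sq_le hN₀pos hN₀x hcq) (by positivity)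
      _ = 16 * T * b q ^ 3 := by ring
  -- ### the sum over `a`: `φ(q)` classes
  have hmid : ∀ q ∈ Finset.Icc 2 ⌊Λ / 2⌋₊,
      ∑ a ∈ (Finset.range q).filter (fun a : ℕ => q.Coprime a),
        ∑ r ∈ (Finset.range N₀).filter (fun r : ℕ => |(r : ℝ) / N₀ - (a : ℝ) / q| ≤ Λ / 2 / x),
          ‖smoothWeightSum (x / 2) y ((r : ℝ) / N₀)‖ ^ 2 * ‖smoothWeightSum x y ((r : ℝ) / N₀)‖ ≤
        (q.totient : ℝ) * (16 * T * b q ^ 3) := by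
    intro q hq
    calc _ ≤ ∑ a ∈ (Finset.range q).filter (fun a : ℕ => q.Coprime a), 16 * T * b q ^ 3 :=
          Finset.sum_le_sum fun a ha => harc q hq a ha
      _ = (q.totient : ℝ) * (16 * T * b q ^ 3) := by
          rw [Finset.sum_const, nsmul_eq_mul, Nat.totient_eq_card_coprime]
  -- ### the sum over `q`: Euler products
  have hbcube : ∀ q ∈ Finset.Icc 2 ⌊Λ / 2⌋₊, (q.totient : ℝ) * (16 * T * b q ^ 3) ≤
      16 * T * (32 * ((q.totient : ℝ) * localG α q ^ 3) + 4 * (ε + 2 * Real.exp (-66)) ^ 3 * ((q.totient : ℝ) * localH α q ^ 3)) := by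
    intro q hq
    have hq0 : q ≠ 0 := by have := (Finset.mem_Icc.mp hq).1; omega
    have hG0 := (localG_bounds hα1 hq0).1
    have hH0 := (localH_bounds hα1 hq0).1
    have hε'' : 0 ≤ ε + 2 * Real.exp (-66) := by positivity
    have h3 := add_pow_three_le (u := 2 * localG α q) (v := (ε + 2 * Real.exp (-66)) * localH α q) (by positivity) (by positivity)
    have hφ0 : (0 : ℝ) ≤ q.totient := Nat.cast_nonneg _
    have : (q.totient : ℝ) * b q ^ 3 ≤ (q.totient : ℝ) * (4 * ((2 * localG α q) ^ 3 + ((ε + 2 * Real.exp (-66)) * localH α q) ^ 3)) :=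
      mul_le_mul_of_nonneg_left h3 hφ0
    calc (q.totient : ℝ) * (16 * T * b q ^ 3) = 16 * T * ((q.totient : ℝ) * b q ^ 3) := by ring
      _ ≤ 16 * T * ((q.totient : ℝ) * (4 * ((2 * localG α q) ^ 3 + ((ε + 2 * Real.exp (-66)) * localH α q) ^ 3))) :=
          mul_le_mul_of_nonneg_left this (by positivity)
      _ = _ := by ring
  have hG := sum_Icc_two_totient_mul_localG_cube_le (show 13 / 15 < α by linarith) hα1 ⌊Λ / 2⌋₊
  have hH := sum_Icc_two_totient_mul_localH_cube_le (show 2 / 3 < α by linarith) hα1 ⌊Λ / 2⌋₊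
  have hnum := arcs_numeric hαlo hα1 hε hε1
  have hHsum0 : 0 ≤ ∑ q ∈ Finset.Icc 2 ⌊Λ / 2⌋₊, (q.totient : ℝ) * localH α q ^ 3 :=
    Finset.sum_nonneg fun q hq => by
      have hq0 : q ≠ 0 := by have := (Finset.mem_Icc.mp hq).1; omega
      have := (localH_bounds hα1 hq0).1; positivity
  calc _ ≤ ∑ q ∈ Finset.Icc 2 ⌊Λ / 2⌋₊, (q.totient : ℝ) * (16 * T * b q ^ 3) := Finset.sum_le_sum hmid
    _ ≤ ∑ q ∈ Finset.Icc 2 ⌊Λ / 2⌋₊, 16 * T * (32 * ((q.totient : ℝ) * localG α q ^ 3) +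
          4 * (ε + 2 * Real.exp (-66)) ^ 3 * ((q.totient : ℝ) * localH α q ^ 3)) := Finset.sum_le_sum hbcube
    _ = 16 * T * (32 * ∑ q ∈ Finset.Icc 2 ⌊Λ / 2⌋₊, (q.totient : ℝ) * localG α q ^ 3 +
          4 * (ε + 2 * Real.exp (-66)) ^ 3 * ∑ q ∈ Finset.Icc 2 ⌊Λ / 2⌋₊, (q.totient : ℝ) * localH α q ^ 3) := by
        rw [← Finset.mul_sum, Finset.sum_add_distrib, ← Finset.mul_sum, ← Finset.mul_sum]
    _ ≤ 16 * T * (32 * (Real.exp (2000 * (1 - α) ^ 3 / (3 * α - 13 / 5)) - 1) +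
          4 * (ε + 2 * Real.exp (-66)) ^ 3 * Real.exp (128 / (3 * α - 2))) := by
        apply mul_le_mul_of_nonneg_left _ (by positivity)
        have hε3 : 0 ≤ 4 * (ε + 2 * Real.exp (-66)) ^ 3 := by positivity
        nlinarith [mul_le_mul_of_nonneg_left hH hε3]
    _ ≤ 16 * T * (1 / 2 : ℝ) ^ 36 := mul_le_mul_of_nonneg_left hnum (by positivity)
    _ = M₁ ^ 2 * Mx * (1 / 2 : ℝ) ^ 32 := by rw [hT]; ring

end Endgame

end Literature.NumberTheory.Sieve

end
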